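import Summits.CriticalPhenomena.PercolationContinuityZ3.Theorems.PercNearOneGluingNoHeavyLowerTailSahiCombTriWFaceSplit
import Summits.CriticalPhenomena.PercolationContinuityZ3.Theorems.PercNearOneGluingNoHeavyLowerTailSahiCombTriWThreshold
import Summits.CriticalPhenomena.PercolationContinuityZ3.Theorems.PercNearOneGluingNoHeavyLowerTailSahiCombTriWPrincipal

/-!
# FACE-MIN inside the class of symmetric THRESHOLD test sets — an induction route to `TriWIneq` for every `P_k`

Support file of the one-cut programme (crux `NoHeavyLowerTail`, stmt-CriticalPhenomena-4575; cell `prim-masterthm`, seat P5 gen 25;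
memo `FROM-prim-masterthm-p5-g25-CYLINDER-CLOSURE.md` §2g).

The threshold families `P_k = {w | k ≤ #w}` (`thresholdFamily`, `…SahiCombTriWThreshold`) are CLOSED UNDER TAKING FACES: along any coordinate `i`
the bottom face of `P_k ⊆ 2^γ` is `P_k ⊆ 2^(γ∖i)` and the top face is `P_{k−1} ⊆ 2^(γ∖i)` (`faceBot_thresholdFamily`, `faceTop_thresholdFamily`).
Hence the face-minimum inequality RESTRICTED TO THRESHOLD TEST SETS already drives an induction on the dimension that never leaves the class:

* `FaceMinThresholdIneq` (`@[conjecture]`, typed; an obligation of this theory, never a fact): for every `k`, EVERY coordinate `i`, every index cube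
  and all monotone families of up-sets, `min (triW P_k⁰ F⁰ G⁰) (triW P_k¹ F¹ G¹) ≤ triW P_k F G`.
  EVIDENCE (this seat, exact-closure annealer code25/c/anneal_fface7.c mode 9: `P` a threshold family, `F, G` free, single-coordinate attack):
  0 failures at `(a,n) = (1,6), (1,7), (1,8), (2,5), (2,6), (2,7), (3,4), (3,5)` (4.2·10⁷ evaluations; in every cell even `Σ_i triW P_k⁰ F⁰ G⁰ ≤ n · triW P_k F G`
  was never violated), further cells in the memo; the symmetric sub-census (`F, G` level families too) is 0 / tight up to `(1,8), (2,6), (3,4)`.  For a GENERAL test set the per-coordinate form is false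
  (`not_faceMinIneq`); for thresholds every coordinate has the largest bottom face, so this is also the threshold case of `FaceMinAtMaxBotIneq`.
* **`triW_nonneg_threshold_of_faceMinThreshold : FaceMinThresholdIneq → ∀ k, 0 ≤ triW (thresholdFamily γ k) F G`** — `TriWIneq` for EVERY symmetric
  threshold, every index cube (induction on `#γ`; compare `…SahiCombTriWThreshold`: unconditional for `2k ≤ #γ + 1`, and for `2k ≥ #γ + 2` conditional on
  the outer-layer Kleitman conjecture `ThresholdCorNonneg` — a statement of a different nature).
HONEST LABEL: two face lemmas and a proved reduction; `FaceMinThresholdIneq` is a CONJECTURE with its census. [this work]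
-/

namespace Summit.CriticalPhenomena.PercolationContinuityZ3.Theorems

namespace FiveUpSet

open Finset

variable {β γ : Type} [DecidableEq β] [Fintype β] [DecidableEq γ] [Fintype γ]

omit [DecidableEq γ] [Fintype γ] in
/-- The face embedding preserves cardinality. [this work] -/
theorem card_faceLift (i : γ) (s : Finset {j : γ // j ≠ i}) : (faceLift i s).card = s.card := by
  rw [faceLift, card_map]

/-- **The bottom face of a threshold family is the same threshold one dimension down.** [this work] -/
theorem faceBot_thresholdFamily (i : γ) (k : ℕ) :
    faceBot i (thresholdFamily γ k) = thresholdFamily {j : γ // j ≠ i} k := by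
  ext s
  rw [mem_faceBot, mem_thresholdFamily, mem_thresholdFamily, card_faceLift]

/-- **The top face of a threshold family is the previous threshold one dimension down** (`k − 1` in `ℕ`, so `P_0 ↦ P_0`). [this work] -/
theorem faceTop_thresholdFamily (i : γ) (k : ℕ) :
    faceTop i (thresholdFamily γ k) = thresholdFamily {j : γ // j ≠ i} (k - 1) := by
  ext s
  rw [mem_faceTop, mem_thresholdFamily, mem_thresholdFamily, card_insert_of_notMem (not_mem_faceLift i s), card_faceLift]
  omega

/-- **(FACE-MIN for thresholds)** (CONJECTURE — an obligation of our theory, never a fact; census in the file header).  For every finite cube, every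
`k`, EVERY coordinate `i`, every index cube and all monotone families of up-sets `F, G`:
`min (triW P_k⁰ F⁰ G⁰) (triW P_k¹ F¹ G¹) ≤ triW P_k F G` (faces along `i`; `P_k = thresholdFamily γ k`). [this work] -/
@[conjecture] def FaceMinThresholdIneq : Prop :=
  ∀ (β γ : Type) [DecidableEq β] [Fintype β] [DecidableEq γ] [Fintype γ]
    (i : γ) (k : ℕ) (F G : Finset β → Finset (Finset γ)),
    (∀ x, IsUpperSet (F x : Set (Finset γ))) → (∀ x, IsUpperSet (G x : Set (Finset γ))) → Monotone F → Monotone G →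
      min (triW (faceBot i (thresholdFamily γ k)) (fun x => faceBot i (F x)) (fun x => faceBot i (G x)))
          (triW (faceTop i (thresholdFamily γ k)) (fun x => faceTop i (F x)) (fun x => faceTop i (G x))) ≤ triW (thresholdFamily γ k) F G

/-- **`FaceMinThresholdIneq ⟹ TriWIneq` for every symmetric threshold family, every index cube** — induction on the dimension inside the
threshold class (both faces of `P_k` are threshold families of the smaller cube). [this work] -/
theorem triW_nonneg_threshold_of_faceMinThreshold (h : FaceMinThresholdIneq) (k : ℕ) (F G : Finset β → Finset (Finset γ))
    (hF : ∀ x, IsUpperSet (F x : Set (Finset γ))) (hG : ∀ x, IsUpperSet (G x : Set (Finset γ))) (hFm : Monotone F) (hGm : Monotone G) :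
    0 ≤ triW (thresholdFamily γ k) F G := by
  suffices key : ∀ (n : ℕ) (γ : Type) [DecidableEq γ] [Fintype γ], Fintype.card γ = n →
      ∀ (k : ℕ) (F G : Finset β → Finset (Finset γ)),
        (∀ x, IsUpperSet (F x : Set (Finset γ))) → (∀ x, IsUpperSet (G x : Set (Finset γ))) → Monotone F → Monotone G →
        0 ≤ triW (thresholdFamily γ k) F G from
    key _ γ rfl k F G hF hG hFm hGm
  intro n
  induction n with
  | zero =>
    intro γ _ _ hcard k F G hF hG hFm hGm
    haveI : IsEmpty γ := Fintype.card_eq_zero_iff.1 hcard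
    exact triW_nonneg_of_isEmpty _ F G (isUpperSet_thresholdFamily k) hF hG hFm hGm
  | succ n ih =>
    intro γ _ _ hcard k F G hF hG hFm hGm
    have hne : Nonempty γ := Fintype.card_pos_iff.1 (by omega)
    obtain ⟨i⟩ := hne
    have hmin := h β γ i k F G hF hG hFm hGm
    have hcard' : Fintype.card {j : γ // j ≠ i} = n := by
      rw [card_subtype_ne, hcard, Nat.add_sub_cancel]
    have hB : 0 ≤ triW (faceBot i (thresholdFamily γ k)) (fun x => faceBot i (F x)) (fun x => faceBot i (G x)) := by
      rw [faceBot_thresholdFamily]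
      exact ih {j : γ // j ≠ i} hcard' k _ _ (fun x => isUpperSet_faceBot i (hF x)) (fun x => isUpperSet_faceBot i (hG x))
        (fun x y hxy => faceBot_mono i (hFm hxy)) (fun x y hxy => faceBot_mono i (hGm hxy))
    have hU : 0 ≤ triW (faceTop i (thresholdFamily γ k)) (fun x => faceTop i (F x)) (fun x => faceTop i (G x)) := by
      rw [faceTop_thresholdFamily]
      exact ih {j : γ // j ≠ i} hcard' (k - 1) _ _ (fun x => isUpperSet_faceTop i (hF x)) (fun x => isUpperSet_faceTop i (hG x))
        (fun x y hxy => faceTop_mono i (hFm hxy)) (fun x y hxy => faceTop_mono i (hGm hxy))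
    exact (le_min hB hU).trans hmin

/-! ### The boundary cases of `FaceMinThresholdIneq` (appended): empty and top thresholds

For `k > #γ` the threshold family and both of its faces are empty, and for `k = #γ` it is the principal up-set `{univ}` with an empty bottom face;
in both cases the face-minimum inequality holds at every coordinate unconditionally (`faceMinThreshold_of_card_lt`, `faceMinThreshold_card`).
(The other end, `k = 0`, is the case "`P` ignores every coordinate" of `…SahiCombTriWFaceMinCylinder`.) [this work] -/

/-- `triW` of the empty test family vanishes. [this work] -/
theorem triW_empty_family (F G : Finset β → Finset (Finset γ)) : triW (∅ : Finset (Finset γ)) F G = 0 := by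
  unfold triW triWTerm
  simp

omit [DecidableEq β] [Fintype β] in
/-- Above the top, the threshold family is empty: `#γ < k ⟹ P_k = ∅`. [this work] -/
theorem thresholdFamily_eq_empty {k : ℕ} (hk : Fintype.card γ < k) : thresholdFamily γ k = ∅ := by
  ext w
  simp only [mem_thresholdFamily, notMem_empty, iff_false, not_le]
  exact (card_le_univ w).trans_lt (by simpa using hk)

omit [DecidableEq β] [Fintype β] in
/-- At the top, the threshold family is the principal up-set `{univ}` (as a filter: `univ ⊆ t`). [this work] -/
theorem thresholdFamily_card_eq : thresholdFamily γ (Fintype.card γ) = univ.filter fun t : Finset γ => (univ : Finset γ) ⊆ t := by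
  ext w
  simp only [mem_thresholdFamily, mem_filter, mem_univ, true_and, univ_subset_iff]
  constructor
  · intro h; exact eq_univ_of_card w (le_antisymm (card_le_univ w) h)
  · intro h; rw [h, card_univ]

/-- **`FaceMinThresholdIneq` above the top threshold** (`#γ < k`): everything vanishes. [this work] -/
theorem faceMinThreshold_of_card_lt (i : γ) {k : ℕ} (hk : Fintype.card γ < k) (F G : Finset β → Finset (Finset γ)) :
    min (triW (faceBot i (thresholdFamily γ k)) (fun x => faceBot i (F x)) (fun x => faceBot i (G x)))
        (triW (faceTop i (thresholdFamily γ k)) (fun x => faceTop i (F x)) (fun x => faceTop i (G x))) ≤ triW (thresholdFamily γ k) F G := by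
  have h1 : Fintype.card {j : γ // j ≠ i} < k := by rw [card_subtype_ne]; omega
  have h2 : Fintype.card {j : γ // j ≠ i} < k - 1 := by
    rw [card_subtype_ne]; have := Fintype.card_pos_iff.2 ⟨i⟩; omega
  rw [faceBot_thresholdFamily, faceTop_thresholdFamily, thresholdFamily_eq_empty hk, thresholdFamily_eq_empty h1, thresholdFamily_eq_empty h2,
    triW_empty_family, triW_empty_family, triW_empty_family, min_self]

/-- **`FaceMinThresholdIneq` at the top threshold** (`k = #γ`, `P = {univ}`): the bottom face is empty (`B = 0`) and `T ≥ 0` by the principal stratum. [this work] -/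
theorem faceMinThreshold_card (i : γ) (F G : Finset β → Finset (Finset γ))
    (hF : ∀ x, IsUpperSet (F x : Set (Finset γ))) (hG : ∀ x, IsUpperSet (G x : Set (Finset γ))) (hFm : Monotone F) (hGm : Monotone G) :
    min (triW (faceBot i (thresholdFamily γ (Fintype.card γ))) (fun x => faceBot i (F x)) (fun x => faceBot i (G x)))
        (triW (faceTop i (thresholdFamily γ (Fintype.card γ))) (fun x => faceTop i (F x)) (fun x => faceTop i (G x)))
      ≤ triW (thresholdFamily γ (Fintype.card γ)) F G := by
  have h1 : Fintype.card {j : γ // j ≠ i} < Fintype.card γ := by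
    rw [card_subtype_ne]; have := Fintype.card_pos_iff.2 ⟨i⟩; omega
  have hB : triW (faceBot i (thresholdFamily γ (Fintype.card γ))) (fun x => faceBot i (F x)) (fun x => faceBot i (G x)) = 0 := by
    rw [faceBot_thresholdFamily, thresholdFamily_eq_empty h1, triW_empty_family]
  have hT : 0 ≤ triW (thresholdFamily γ (Fintype.card γ)) F G := by
    rw [thresholdFamily_card_eq]
    exact triW_nonneg_of_principal univ F G hF hG hFm hGm
  rw [hB]
  exact (min_le_left _ _).trans hT

end FiveUpSet

end Summit.CriticalPhenomena.PercolationContinuityZ3.Theorems
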